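import Literature.RingTheory.SimpleModule.LocalRingModuloRadical
import Mathlib.RingTheory.Ideal.Quotient.Operations
import Mathlib.RingTheory.TensorProduct.Maps
import Mathlib.LinearAlgebra.TensorProduct.Basis
import Mathlib.LinearAlgebra.StdBasis
import Mathlib.Algebra.Algebra.Pi
import Mathlib.Algebra.BigOperators.Pi
import HarnessLib

/-!
# [StacksProject Tag 00U8; Tag 04GG] Characters of the split algebra `R^ι`: over a LOCAL ring every `R`-algebra map `R^ι → R` is an evaluation;
# the characters `φᵢ ⊗ φⱼ` of the tensor square of `A ⧸ ker(φᵢ)ᵢ ≅ R^ι` are jointly injective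

Topic `RingTheory/Idempotents`; namespace `Literature.RingTheory.Idempotents`.  THEOREMS ONLY (no definition, no instance, no notation, no named
fact, no `sorry`); Mathlib + one ★ lemma (idempotents of a local ring).  Cell `pub/hodgecm-mathlib` (D-0151), programme P6 «MOD», sub-line `Cruxes/HLiu418/Lines/F0_P6b_ConnectedEtale.lean`,
stub `stub_b4g_etaleClosureOfGenericSubgroup_henselian` strategy σ2 «SECTIONS FIRST» (desk F0P6b-plan (g0) 13:42:14Z ∕ 13:52:10Z; hand B-p12 (g30)):
brick (F1″), companion of ★-lane (F1′) `RingTheory/Ideal/ComaximalKernelsOfLocalSections` (CRT for sections with distinct closed points).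
HONEST LABEL: HC_CM is proved only modulo the printed citations (hLiu418, h413) until rung 0 closes; this file is count-neutral commutative algebra.

THE MATHEMATICS.  `R` a commutative ring, `ι` finite.
* §1 (`R` LOCAL).  An idempotent of a local ring is `0` or `1` (★ `SimpleModule.IsIdempotentElem.eq_zero_or_eq_one_of_isLocalRing`).  Hence an `R`-algebra map
  `ψ : (ι → R) →ₐ[R] R` sends the standard idempotents `δᵢ` to orthogonal idempotents of `R` summing to `1`, so exactly one `ψ(δᵢ₀) = 1` and
  `ψ = ev_{i₀}` (`exists_algHom_pi_eq_evalAlgHom`: the connected scheme `Spec R` maps to `∐_ι Spec R` through one summand).  Consequently, for a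
  family of characters `φ : ι → (A →ₐ[R] R)` whose evaluation map `π = (φᵢ)ᵢ : A → R^ι` is SURJECTIVE, every character `ψ : A →ₐ[R] R` killing
  `ker π` IS one of the `φᵢ` (`exists_eq_of_ker_pi_le_ker`) — «the `R`-points of the constant scheme `Spec (A ⧸ ker π) ≅ ∐_ι Spec R` are the `φᵢ`».
* §2 (any `R`).  With `π` surjective, `A ⧸ ker π ≅ R^ι` is free on `δᵢ`, its tensor square is free on `δᵢ ⊗ δⱼ`, and the coordinate of `z` at
  `δᵢ ⊗ δⱼ` is the character `φ̄ᵢ ⊗ φ̄ⱼ` applied to `z`; so an element of `A ⊗[R] A` killed by every `φᵢ ⊗ φⱼ` (`Algebra.TensorProduct.lift`)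
  dies in `(A ⧸ ker π) ⊗[R] (A ⧸ ker π)` (`map_mk_eq_zero_of_forall_lift_eq_zero`).  This is the coideal half of «`⨅ ker φᵢ` is a Hopf ideal
  when the `φᵢ` form a finite subgroup of points» (sequel, `GroupSchemes/HopfIdealOfFiniteSubgroupOfPoints`).

## References
* [StacksProject] The Stacks Project: Tag 00U8 (products of rings, idempotents), Tag 04GG (finite algebras over henselian local rings: sections ↔ factors).
* [Tate1997FiniteFlatGroupSchemes] J. Tate, *Finite flat group schemes* (1997): (3.7) (étale part and sections over a henselian base).
-/

set_option autoImplicit false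

namespace Literature.RingTheory.Idempotents

open IsLocalRing TensorProduct Module

/-! ## §1 Characters of `R^ι` over a local ring are evaluations -/

section Local

variable {R : Type*} [CommRing R] [IsLocalRing R]

variable {ι : Type*} [Finite ι]

/-- **CHARACTERS OF `R^ι` OVER A LOCAL RING ARE EVALUATIONS**: every `R`-algebra map `(ι → R) →ₐ[R] R` (`R` local, `ι` finite) is
`Pi.evalAlgHom R _ i₀` for a (unique) `i₀` — `Spec R` is connected, so a section of `∐_ι Spec R → Spec R` lies in one summand.
[cite: StacksProject, Tag 00U8] [cite: StacksProject, Tag 04GG] -/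
theorem exists_algHom_pi_eq_evalAlgHom (ψ : (ι → R) →ₐ[R] R) : ∃ i, ψ = Pi.evalAlgHom R (fun _ => R) i := by
  classical
  cases nonempty_fintype ι
  -- the images `ψ δᵢ` of the standard idempotents are idempotents of `R`, hence `0` or `1`
  have hidem : ∀ i, ψ (Pi.single i 1) = 0 ∨ ψ (Pi.single i 1) = 1 := fun i =>
    Literature.RingTheory.SimpleModule.IsIdempotentElem.eq_zero_or_eq_one_of_isLocalRing
      (by rw [IsIdempotentElem, ← map_mul, ← Pi.single_mul, mul_one])
  -- they sum to `1`
  have hsum : ∑ i, ψ (Pi.single i (1 : R)) = 1 := by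
    rw [← map_sum]
    have h1 : (∑ i, Pi.single i (1 : R) : ι → R) = 1 := by
      have := Finset.univ_sum_single (1 : ι → R)
      simpa only [Pi.one_apply] using this
    rw [h1, map_one]
  -- so one of them is `1`
  obtain ⟨i₀, hi₀⟩ : ∃ i, ψ (Pi.single i 1) = 1 := by
    by_contra h
    push Not at h
    have h0 : ∑ i, ψ (Pi.single i (1 : R)) = 0 := Finset.sum_eq_zero fun i _ => (hidem i).resolve_right (h i)
    rw [hsum] at h0
    exact one_ne_zero h0
  refine ⟨i₀, ?_⟩
  -- and the others are `0` (orthogonality)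
  have hj : ∀ j, j ≠ i₀ → ψ (Pi.single j 1) = 0 := fun j hji => by
    have hz : (Pi.single j (1 : R) : ι → R) * Pi.single i₀ 1 = 0 := by
      funext k
      rw [Pi.mul_apply, Pi.zero_apply, Pi.single_apply, Pi.single_apply]
      by_cases hk : k = j
      · subst hk; rw [if_pos rfl, if_neg hji, mul_zero]
      · rw [if_neg hk, zero_mul]
    have := congrArg ψ hz
    rwa [map_mul, hi₀, mul_one, map_zero] at this
  apply AlgHom.ext
  intro f
  rw [Pi.evalAlgHom_apply]
  conv_lhs => rw [← Finset.univ_sum_single f, map_sum]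
  rw [Finset.sum_eq_single i₀ (fun j _ hji => ?_) (fun h => absurd (Finset.mem_univ i₀) h)]
  · rw [show (Pi.single i₀ (f i₀) : ι → R) = f i₀ • Pi.single i₀ 1 by rw [← Pi.single_smul, smul_eq_mul, mul_one], map_smul, hi₀,
      smul_eq_mul, mul_one]
  · rw [show (Pi.single j (f j) : ι → R) = f j • Pi.single j 1 by rw [← Pi.single_smul, smul_eq_mul, mul_one], map_smul, hj j hji, smul_zero]

variable {A : Type*} [CommRing A] [Algebra R A]

/-- **A CHARACTER KILLING `ker (φᵢ)ᵢ` IS ONE OF THE `φᵢ`** (`R` local, `ι` finite, the evaluation map `π = (φᵢ)ᵢ : A → R^ι` SURJECTIVE): an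
`R`-algebra map `ψ : A →ₐ[R] R` with `ker π ≤ ker ψ` factors through `A ⧸ ker π ≅ R^ι` (Mathlib `AlgHom.liftOfSurjective`), where it is an
evaluation (§1). The `R`-points of the constant closed subscheme `Spec (A ⧸ ker π)` are exactly the `φᵢ`. [cite: StacksProject, Tag 04GG] -/
theorem exists_eq_of_ker_pi_le_ker (φ : ι → (A →ₐ[R] R)) (hπ : Function.Surjective (AlgHom.pi φ : A →ₐ[R] (ι → R))) (ψ : A →ₐ[R] R)
    (hψ : RingHom.ker (AlgHom.pi φ : A →ₐ[R] (ι → R)).toRingHom ≤ RingHom.ker ψ.toRingHom) : ∃ i, ψ = φ i := by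
  obtain ⟨i, hi⟩ := exists_algHom_pi_eq_evalAlgHom (AlgHom.liftOfSurjective _ hπ ψ hψ)
  refine ⟨i, AlgHom.ext fun a => ?_⟩
  have h := AlgHom.liftOfSurjective_apply _ hπ ψ hψ a
  rw [hi, Pi.evalAlgHom_apply, AlgHom.pi_apply] at h
  exact h.symm

end Local

/-! ## §2 The characters `φᵢ ⊗ φⱼ` of the tensor square of `A ⧸ ker π ≅ R^ι` are jointly injective -/

section Tensor

variable {R : Type*} [CommRing R] {ι : Type*} [Finite ι] {A : Type*} [CommRing A] [Algebra R A]

/-- For an `R`-algebra isomorphism `e : Q ≃ₐ[R] (ι → R)` the characters `evᵢ ∘ e ⊗ evⱼ ∘ e` of `Q ⊗[R] Q` are JOINTLY INJECTIVE: `Q ⊗ Q` is free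
on `δᵢ ⊗ δⱼ` and the `(i, j)` coordinate is that character. [cite: StacksProject, Tag 00U8] -/
theorem eq_zero_of_forall_lift_evalAlgHom_comp_eq_zero {Q : Type*} [CommRing Q] [Algebra R Q] (e : Q ≃ₐ[R] (ι → R)) (z : Q ⊗[R] Q)
    (h : ∀ i j, Algebra.TensorProduct.lift ((Pi.evalAlgHom R (fun _ => R) i).comp (e : Q →ₐ[R] (ι → R)))
      ((Pi.evalAlgHom R (fun _ => R) j).comp (e : Q →ₐ[R] (ι → R))) (fun _ _ => .all _ _) z = 0) : z = 0 := by
  classical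
  cases nonempty_fintype ι
  let b : Basis ι R Q := (Pi.basisFun R ι).map e.toLinearEquiv.symm
  let B : Basis (ι × ι) R (Q ⊗[R] Q) := b.tensorProduct b
  have hb : ∀ i, b i = e.symm (Pi.single i 1) := fun i => by
    simp only [b, Basis.map_apply, Pi.basisFun_apply]
    rfl
  -- the `(i, j)` coordinate functional is the character `evᵢ ∘ e ⊗ evⱼ ∘ e`
  have hcoord : ∀ i j, B.coord (i, j) = (Algebra.TensorProduct.lift ((Pi.evalAlgHom R (fun _ => R) i).comp (e : Q →ₐ[R] (ι → R)))
      ((Pi.evalAlgHom R (fun _ => R) j).comp (e : Q →ₐ[R] (ι → R))) (fun _ _ => .all _ _)).toLinearMap := fun i j => by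
    refine B.ext fun p => ?_
    obtain ⟨i', j'⟩ := p
    rw [Basis.coord_apply, Basis.repr_self, AlgHom.toLinearMap_apply]
    change _ = Algebra.TensorProduct.lift _ _ _ ((b.tensorProduct b) (i', j'))
    rw [Basis.tensorProduct_apply, Algebra.TensorProduct.lift_tmul, hb, hb]
    simp only [AlgHom.coe_comp, Function.comp_apply, AlgEquiv.coe_toAlgHom, AlgEquiv.apply_symm_apply, Pi.evalAlgHom_apply,
      Finsupp.single_apply, Prod.mk.injEq]
    by_cases h1 : i = i' <;> by_cases h2 : j = j' <;> simp [h1, h2, eq_comm]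
  refine B.ext_elem fun p => ?_
  obtain ⟨i, j⟩ := p
  rw [map_zero, Finsupp.zero_apply, ← Basis.coord_apply, hcoord, AlgHom.toLinearMap_apply, h i j]

/-- **AN ELEMENT OF `A ⊗ A` KILLED BY EVERY `φᵢ ⊗ φⱼ` DIES IN `(A ⧸ ker π) ⊗ (A ⧸ ker π)`** (`π = (φᵢ)ᵢ : A → R^ι` SURJECTIVE, `ι` finite, any
commutative `R`): the characters `φᵢ ⊗ φⱼ` factor through the quotient, which is `≅ R^ι` (Mathlib `Ideal.quotientKerAlgEquivOfSurjective`), where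
they are the coordinates of the basis `δᵢ ⊗ δⱼ`.  The coideal clause of «the ideal of a finite subgroup of points is a Hopf ideal».
[cite: StacksProject, Tag 00U8] [cite: Tate1997FiniteFlatGroupSchemes, (3.7)] -/
theorem map_mk_eq_zero_of_forall_lift_eq_zero (φ : ι → (A →ₐ[R] R)) (hπ : Function.Surjective (AlgHom.pi φ : A →ₐ[R] (ι → R)))
    (y : A ⊗[R] A) (h : ∀ i j, Algebra.TensorProduct.lift (φ i) (φ j) (fun _ _ => .all _ _) y = 0) :
    Algebra.TensorProduct.map (Ideal.Quotient.mkₐ R (RingHom.ker (AlgHom.pi φ : A →ₐ[R] (ι → R))))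
      (Ideal.Quotient.mkₐ R (RingHom.ker (AlgHom.pi φ : A →ₐ[R] (ι → R)))) y = 0 := by
  set I : Ideal A := RingHom.ker (AlgHom.pi φ : A →ₐ[R] (ι → R)) with hI
  let e : (A ⧸ I) ≃ₐ[R] (ι → R) := Ideal.quotientKerAlgEquivOfSurjective hπ
  refine eq_zero_of_forall_lift_evalAlgHom_comp_eq_zero e _ fun i j => ?_
  -- `(evᵢ ∘ e) ∘ mk = φᵢ`
  have hev : ∀ i, ((Pi.evalAlgHom R (fun _ => R) i).comp (e : (A ⧸ I) →ₐ[R] (ι → R))).comp (Ideal.Quotient.mkₐ R I) = φ i := fun i => by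
    refine AlgHom.ext fun a => ?_
    simp only [AlgHom.coe_comp, Function.comp_apply, Ideal.Quotient.mkₐ_eq_mk, AlgEquiv.coe_toAlgHom, Pi.evalAlgHom_apply]
    rw [Ideal.quotientKerAlgEquivOfSurjective_mk, AlgHom.pi_apply]
  have hcomp : (Algebra.TensorProduct.lift ((Pi.evalAlgHom R (fun _ => R) i).comp (e : (A ⧸ I) →ₐ[R] (ι → R)))
      ((Pi.evalAlgHom R (fun _ => R) j).comp (e : (A ⧸ I) →ₐ[R] (ι → R))) (fun _ _ => .all _ _)).comp
      (Algebra.TensorProduct.map (Ideal.Quotient.mkₐ R I) (Ideal.Quotient.mkₐ R I)) =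
      Algebra.TensorProduct.lift (φ i) (φ j) (fun _ _ => .all _ _) := by
    refine Algebra.TensorProduct.ext' fun a a' => ?_
    rw [AlgHom.comp_apply, Algebra.TensorProduct.map_tmul, Algebra.TensorProduct.lift_tmul, Algebra.TensorProduct.lift_tmul,
      ← hev i, ← hev j]
    rfl
  have := congrArg (fun f : A ⊗[R] A →ₐ[R] R => f y) hcomp
  simp only [AlgHom.comp_apply] at this
  rw [this]
  exact h i j

end Tensor

end Literature.RingTheory.Idempotents
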